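import Summits.QuantumFields.BalabanUV.Beta.GAN24.ValueJetChargeZero
import Summits.QuantumFields.BalabanUV.Beta.GAN24.WilsonVertexTwoConst

/-!
# `BalabanUV.Beta.GAN24.SpureChargeZero` — row G-an2-4 ∕ (CONV-C), W-slot, SKELETON-W3 §7.2 SUM RULE (S3c) IN THE CENSUS CURRENCY:
# an2's FIRST FIELD TABLE `Spure m` AND ITS NORMALISED FORM `S̃_m = unitS s_f s_m (Spure m)` CONTRACTED WITH ANY TWO CONSTANT FIELD LEGS VANISH — EVERY MEMBER `m`

NOT IN PRINT; OUR PROOF ATTEMPT (idle-seat kernel lemma under the row owner's RULINGS-13 invitation «W3-S3C*», unit `b2b-balaban-gan24-formalise-leaf-06`,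
gen 8; the packaging twin, for members `m ≥ 1`, of leaf-19's `GAN24/WilsonVertexTwoConst` §4 (member `0`) — same statement shapes, so the W3-F2a («W3-ZS*»)
prover has ONE uniform API for the census object `S̃_m` of SKELETON-W3 v1.0 §7.2 at every level).  HONEST FRAMING (cell contract, verbatim): «discharging
`BetaPertH` makes Bałaban's UV stability UNCONDITIONAL — a real constructive-QFT result; it is NOT the continuum limit and NOT the Clay problem.»  HONEST
DEPENDENCY (verbatim): «continuum YM on T⁴ ⇐ BetaPertH ∧ nine spine estimates (0/9 proved); BetaPertH ⇐ (D1) ∧ (D4) ∧ CAP+tail; G-an2-4 gates asym, D1 and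
NE2/3/4.»

WHAT ([folklore]; generic `d`, `Lc ≥ 1`, all `cE cVH cΛ`, all units `s_f s_m`; 0 `def`, 0 cite, 0 sorry).  `BalabanStepW2.Spure … (j+1) κ′ u = (cE·wE (j+1)) • e3Of … (j+1) κ′ u
+ (cVH·wVH (j+1)) • mfNeg (vhS …)`; the border is OFF the field–field block (`packVH_inl_inl`), so the ff-entry is `cE·wE (j+1)` times the `e3Of` entry
(`Spure_succ_inl_inl`), and a further site-independent scalar for `unitS` (leaf-19's `WilsonVertexTwoConst.unitS_inl_inl`).  Hence, from PART 2b
(`ValueJetChargeZero.hasSum_e3Of_inl_inl` ∕ `hasSum_e3Of_bond_fst` ∕ `hasSum_e3Of_bond_snd`), ALL THREE two-leg contractions of `Spure … (j+1)` and of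
`unitS s_f s_m (Spure … (j+1))` vanish, in the `HasSum`-on-pairs and in the iterated-`tsum` currencies (§2), and — joining leaf-19's member `0` — for EVERY
member `m` (§3: `hasSum_unitS_Spure`, `hasSum_Spure`).
READING (docstring level, asserted nowhere): (S3c)_m of SKELETON-W3 §7.2 for the census object `S̃_m`.  Asserts NO shape of Bałaban's tables, pins no colour
constant, discharges NOTHING of «T2Shape»∕«T2SupRate»∕(hW, hWall).  NOT «W-slot closed», NEVER «G-an2-4 closed»; NOT BetaPertH, NOT continuum, NOT Clay.
-/

noncomputable section

open Finset
open scoped BigOperators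
open Literature.MathematicalPhysics.QuantumFieldTheory
open Literature.MathematicalPhysics.QuantumFieldTheory.Balaban1983to89
open Literature.MathematicalPhysics.QuantumFieldTheory.Balaban1983to89.Beta
open ExpKernelCalculus (Site MKer)
open StepJetData (mfNeg mfNeg_inl_inl)
open AveragingHessianKernels (vhS packVH_inl_inl)
open BalabanStepJetsSucc (e3Of wE wVH)
open BalabanStepW2 (Spure Spure_succ)
open OneStepResolventKernel (Fib)
open Summit.QuantumFields.BalabanUV.Beta.HessKerDressedUnits (unitS)
open Summit.QuantumFields.BalabanUV.Beta.GAN24.WilsonVertexTwoConst (unitS_inl_inl hasSum_unitS_Spure_zero Spure_zero_inl_inl)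
open Summit.QuantumFields.BalabanUV.Beta.GAN24.ValueJetChargeZero (hasSum_e3Of_inl_inl hasSum_e3Of_bond_fst hasSum_e3Of_bond_snd)
open Summit.QuantumFields.BalabanUV.Beta.GAN24.CompositeStencilChargeZero (mfNeg_vhS_inl_inl)

namespace Summit.QuantumFields.BalabanUV.Beta.GAN24.SpureChargeZero

variable {d : ℕ} {Lc : ℕ} [NeZero Lc]

/-! ## §1 The field–field entries of `Spure … (j+1)` and of `S̃_{j+1}` -/

/-- [folklore] the ff-ENTRY of `Spure … (j+1)`: the (V-H) border is off the field–field block, so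
`Spure … (j+1) κ′ u w y (inl α) (inl β) = (cE·wE (j+1)) · e3Of … (j+1) κ′ u w y (inl α) (inl β)`. -/
theorem Spure_succ_inl_inl (cE cVH cΛ : ℝ) (j : ℕ) (κ' : Fin (d + 1)) (u w y : Site (d + 1)) (α β : Fin (d + 1)) :
    Spure d Lc cE cVH cΛ (j + 1) κ' u w y (Sum.inl α) (Sum.inl β) =
      (cE * wE d Lc (j + 1)) * e3Of d Lc cE cVH cΛ (j + 1) κ' u w y (Sum.inl α) (Sum.inl β) := by
  rw [Spure_succ]
  show (cE * wE d Lc (j + 1)) * e3Of d Lc cE cVH cΛ (j + 1) κ' u w y (Sum.inl α) (Sum.inl β) +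
      (cVH * wVH d Lc (j + 1)) * mfNeg (vhS d Lc κ' u) w y (Sum.inl α) (Sum.inl β) = _
  rw [mfNeg_vhS_inl_inl, mul_zero, add_zero]

/-- [folklore] the ff-ENTRY of the census object `S̃_{j+1} = unitS s_f s_m (Spure … (j+1))`: a site-independent multiple of the `e3Of` entry. -/
theorem unitS_Spure_succ_inl_inl (sf sm cE cVH cΛ : ℝ) (j : ℕ) (κ' : Fin (d + 1)) (u w y : Site (d + 1)) (α β : Fin (d + 1)) :
    unitS sf sm (Spure d Lc cE cVH cΛ (j + 1)) κ' u w y (Sum.inl α) (Sum.inl β) =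
      (sf * sm)⁻¹ * (sf⁻¹ * sf⁻¹) * (cE * wE d Lc (j + 1)) * e3Of d Lc cE cVH cΛ (j + 1) κ' u w y (Sum.inl α) (Sum.inl β) := by
  rw [unitS_inl_inl, Spure_succ_inl_inl]
  ring

/-! ## §2 (S3c)_{j+1}: all three two-leg contractions vanish, `HasSum` and iterated currencies -/

/-- [folklore] **(S3c)_{j+1} FOR `S̃_{j+1}`, `HasSum` CURRENCY** — all three pairs at once: kernel legs (table bond `s` fixed), table site + first leg
(second leg `s` free), table site + second leg (first leg `s` free).  Every `Lc ≥ 1`, all units and colour weights. -/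
theorem hasSum_unitS_Spure_succ (hLc : 1 ≤ Lc) (sf sm cE cVH cΛ : ℝ) (j : ℕ) (κ' : Fin (d + 1)) (α β : Fin (d + 1)) (s : Site (d + 1)) :
    HasSum (fun p : Site (d + 1) × Site (d + 1) =>
        unitS sf sm (Spure d Lc cE cVH cΛ (j + 1)) κ' s p.1 p.2 (Sum.inl α) (Sum.inl β)) 0 ∧
      HasSum (fun p : Site (d + 1) × Site (d + 1) =>
        unitS sf sm (Spure d Lc cE cVH cΛ (j + 1)) κ' p.1 p.2 s (Sum.inl α) (Sum.inl β)) 0 ∧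
      HasSum (fun p : Site (d + 1) × Site (d + 1) =>
        unitS sf sm (Spure d Lc cE cVH cΛ (j + 1)) κ' p.1 s p.2 (Sum.inl α) (Sum.inl β)) 0 := by
  simp_rw [unitS_Spure_succ_inl_inl]
  refine ⟨?_, ?_, ?_⟩
  · simpa using (hasSum_e3Of_inl_inl hLc cE cVH cΛ (j + 1) κ' s α β).mul_left ((sf * sm)⁻¹ * (sf⁻¹ * sf⁻¹) * (cE * wE d Lc (j + 1)))
  · simpa using (hasSum_e3Of_bond_fst hLc cE cVH cΛ j κ' s α β).mul_left ((sf * sm)⁻¹ * (sf⁻¹ * sf⁻¹) * (cE * wE d Lc (j + 1)))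
  · simpa using (hasSum_e3Of_bond_snd hLc cE cVH cΛ j κ' s α β).mul_left ((sf * sm)⁻¹ * (sf⁻¹ * sf⁻¹) * (cE * wE d Lc (j + 1)))

/-- [folklore] **(S3c)_{j+1} FOR THE RAW TABLE `Spure … (j+1)`, `HasSum` CURRENCY** — the same three pairs. -/
theorem hasSum_Spure_succ (hLc : 1 ≤ Lc) (cE cVH cΛ : ℝ) (j : ℕ) (κ' : Fin (d + 1)) (α β : Fin (d + 1)) (s : Site (d + 1)) :
    HasSum (fun p : Site (d + 1) × Site (d + 1) => Spure d Lc cE cVH cΛ (j + 1) κ' s p.1 p.2 (Sum.inl α) (Sum.inl β)) 0 ∧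
      HasSum (fun p : Site (d + 1) × Site (d + 1) => Spure d Lc cE cVH cΛ (j + 1) κ' p.1 p.2 s (Sum.inl α) (Sum.inl β)) 0 ∧
      HasSum (fun p : Site (d + 1) × Site (d + 1) => Spure d Lc cE cVH cΛ (j + 1) κ' p.1 s p.2 (Sum.inl α) (Sum.inl β)) 0 := by
  simp_rw [Spure_succ_inl_inl]
  refine ⟨?_, ?_, ?_⟩
  · simpa using (hasSum_e3Of_inl_inl hLc cE cVH cΛ (j + 1) κ' s α β).mul_left (cE * wE d Lc (j + 1))
  · simpa using (hasSum_e3Of_bond_fst hLc cE cVH cΛ j κ' s α β).mul_left (cE * wE d Lc (j + 1))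
  · simpa using (hasSum_e3Of_bond_snd hLc cE cVH cΛ j κ' s α β).mul_left (cE * wE d Lc (j + 1))

/-- [folklore] (S3c)_{j+1} for `S̃_{j+1}`, KERNEL LEGS SUMMED (table bond fixed), iterated: `∑' w, ∑' y, S̃_{j+1} κ′ u w y (inl α) (inl β) = 0`. -/
theorem unitS_Spure_succ_tsum_legs (hLc : 1 ≤ Lc) (sf sm cE cVH cΛ : ℝ) (j : ℕ) (κ' : Fin (d + 1)) (u : Site (d + 1)) (α β : Fin (d + 1)) :
    ∑' w, ∑' y, unitS sf sm (Spure d Lc cE cVH cΛ (j + 1)) κ' u w y (Sum.inl α) (Sum.inl β) = 0 := by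
  have h := (hasSum_unitS_Spure_succ (d := d) hLc sf sm cE cVH cΛ j κ' α β u).1
  rw [← h.summable.tsum_prod]
  exact h.tsum_eq

/-- [folklore] (S3c)_{j+1} for `S̃_{j+1}`, TABLE SITE + FIRST LEG SUMMED (second leg free): `∑' u, ∑' w, S̃_{j+1} κ′ u w y (inl α) (inl β) = 0`. -/
theorem unitS_Spure_succ_tsum_table_left (hLc : 1 ≤ Lc) (sf sm cE cVH cΛ : ℝ) (j : ℕ) (κ' : Fin (d + 1)) (α β : Fin (d + 1))
    (y : Site (d + 1)) :
    ∑' u, ∑' w, unitS sf sm (Spure d Lc cE cVH cΛ (j + 1)) κ' u w y (Sum.inl α) (Sum.inl β) = 0 := by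
  have h := (hasSum_unitS_Spure_succ (d := d) hLc sf sm cE cVH cΛ j κ' α β y).2.1
  rw [← h.summable.tsum_prod]
  exact h.tsum_eq

/-- [folklore] (S3c)_{j+1} for `S̃_{j+1}`, TABLE SITE + SECOND LEG SUMMED (first leg free): `∑' u, ∑' y, S̃_{j+1} κ′ u w y (inl α) (inl β) = 0`. -/
theorem unitS_Spure_succ_tsum_table_right (hLc : 1 ≤ Lc) (sf sm cE cVH cΛ : ℝ) (j : ℕ) (κ' : Fin (d + 1)) (α β : Fin (d + 1))
    (w : Site (d + 1)) :
    ∑' u, ∑' y, unitS sf sm (Spure d Lc cE cVH cΛ (j + 1)) κ' u w y (Sum.inl α) (Sum.inl β) = 0 := by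
  have h := (hasSum_unitS_Spure_succ (d := d) hLc sf sm cE cVH cΛ j κ' α β w).2.2
  rw [← h.summable.tsum_prod]
  exact h.tsum_eq

/-- [folklore] the raw table, kernel legs summed, iterated. -/
theorem Spure_succ_tsum_legs (hLc : 1 ≤ Lc) (cE cVH cΛ : ℝ) (j : ℕ) (κ' : Fin (d + 1)) (u : Site (d + 1)) (α β : Fin (d + 1)) :
    ∑' w, ∑' y, Spure d Lc cE cVH cΛ (j + 1) κ' u w y (Sum.inl α) (Sum.inl β) = 0 := by
  have h := (hasSum_Spure_succ (d := d) hLc cE cVH cΛ j κ' α β u).1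
  rw [← h.summable.tsum_prod]
  exact h.tsum_eq

/-- [folklore] the raw table, table site + first leg summed, iterated. -/
theorem Spure_succ_tsum_table_left (hLc : 1 ≤ Lc) (cE cVH cΛ : ℝ) (j : ℕ) (κ' : Fin (d + 1)) (α β : Fin (d + 1)) (y : Site (d + 1)) :
    ∑' u, ∑' w, Spure d Lc cE cVH cΛ (j + 1) κ' u w y (Sum.inl α) (Sum.inl β) = 0 := by
  have h := (hasSum_Spure_succ (d := d) hLc cE cVH cΛ j κ' α β y).2.1
  rw [← h.summable.tsum_prod]
  exact h.tsum_eq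

/-- [folklore] the raw table, table site + second leg summed, iterated. -/
theorem Spure_succ_tsum_table_right (hLc : 1 ≤ Lc) (cE cVH cΛ : ℝ) (j : ℕ) (κ' : Fin (d + 1)) (α β : Fin (d + 1)) (w : Site (d + 1)) :
    ∑' u, ∑' y, Spure d Lc cE cVH cΛ (j + 1) κ' u w y (Sum.inl α) (Sum.inl β) = 0 := by
  have h := (hasSum_Spure_succ (d := d) hLc cE cVH cΛ j κ' α β w).2.2
  rw [← h.summable.tsum_prod]
  exact h.tsum_eq

/-! ## §3 (S3c)_m FOR EVERY MEMBER `m` (member `0` = leaf-19's `WilsonVertexTwoConst` BY NAME, members `j+1` = §2) -/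

/-- [folklore] **(S3c)_m FOR THE CENSUS OBJECT `S̃_m = unitS s_f s_m (Spure … m)` — EVERY MEMBER `m`, ALL THREE TWO-LEG PAIRS, `HasSum` CURRENCY.** -/
theorem hasSum_unitS_Spure (hLc : 1 ≤ Lc) (sf sm cE cVH cΛ : ℝ) :
    ∀ (m : ℕ) (κ' : Fin (d + 1)) (α β : Fin (d + 1)) (s : Site (d + 1)),
      HasSum (fun p : Site (d + 1) × Site (d + 1) =>
          unitS sf sm (Spure d Lc cE cVH cΛ m) κ' s p.1 p.2 (Sum.inl α) (Sum.inl β)) 0 ∧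
        HasSum (fun p : Site (d + 1) × Site (d + 1) =>
          unitS sf sm (Spure d Lc cE cVH cΛ m) κ' p.1 p.2 s (Sum.inl α) (Sum.inl β)) 0 ∧
        HasSum (fun p : Site (d + 1) × Site (d + 1) =>
          unitS sf sm (Spure d Lc cE cVH cΛ m) κ' p.1 s p.2 (Sum.inl α) (Sum.inl β)) 0
  | 0, κ', α, β, s => hasSum_unitS_Spure_zero sf sm cE cVH cΛ κ' α β s
  | j + 1, κ', α, β, s => hasSum_unitS_Spure_succ hLc sf sm cE cVH cΛ j κ' α β s

/-- [folklore] **(S3c)_m FOR THE RAW TABLE `Spure … m` — EVERY MEMBER `m`, ALL THREE TWO-LEG PAIRS, `HasSum` CURRENCY** (units `s_f = s_m = 1`). -/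
theorem hasSum_Spure (hLc : 1 ≤ Lc) (cE cVH cΛ : ℝ) (m : ℕ) (κ' : Fin (d + 1)) (α β : Fin (d + 1)) (s : Site (d + 1)) :
    HasSum (fun p : Site (d + 1) × Site (d + 1) => Spure d Lc cE cVH cΛ m κ' s p.1 p.2 (Sum.inl α) (Sum.inl β)) 0 ∧
      HasSum (fun p : Site (d + 1) × Site (d + 1) => Spure d Lc cE cVH cΛ m κ' p.1 p.2 s (Sum.inl α) (Sum.inl β)) 0 ∧
      HasSum (fun p : Site (d + 1) × Site (d + 1) => Spure d Lc cE cVH cΛ m κ' p.1 s p.2 (Sum.inl α) (Sum.inl β)) 0 := by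
  have h := hasSum_unitS_Spure (d := d) hLc 1 1 cE cVH cΛ m κ' α β s
  have e : ∀ (κ : Fin (d + 1)) (u w y : Site (d + 1)),
      unitS 1 1 (Spure d Lc cE cVH cΛ m) κ u w y (Sum.inl α) (Sum.inl β) = Spure d Lc cE cVH cΛ m κ u w y (Sum.inl α) (Sum.inl β) := by
    intro κ u w y
    rw [unitS_inl_inl]
    norm_num
  simp_rw [e] at h
  exact h

end Summit.QuantumFields.BalabanUV.Beta.GAN24.SpureChargeZero

end
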